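import Literature.NumberTheory.Automorphic.QuaternionGLTwoClassesEmbedding
import HarnessLib

/-!
# The standard involution of a quaternion algebra: algebraic toolkit

Topic `NumberTheory/Automorphic`; theorems only (no definition, no named fact, no instance).
The tree defines, for a quaternion algebra `D` over a field `K`, the reduced trace
`reducedTrace K D` (`½ Tr(L_x)`), the standard involution `standardInvolution K D x = trd(x) - x`
and the reduced norm `reducedNorm K D` (`QuaternionAlgebraAdelic.lean`), and proves `x x̄ = nrd x`,
`x̄ x = nrd x`, `nrd(xy) = nrd x · nrd y`, `x² = trd(x) x - nrd(x)` by transport to Mathlib's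
`ℍ[K,a,b]` (`IsQuaternionAlgebra.exists_algEquiv_quaternionAlgebra`). This file completes the
elementary toolkit in the same way (Vignéras, LNM 800, Ch. I §1, Lemme 1.1 and p. 3: "`h ↦ h̄`
est un anti-automorphisme involutif … `t(h) = h + h̄`, `n(h) = h h̄`"; Voight §3.2–3.3, (4.2.16)):

* linearity and involutivity of `x ↦ x̄`: `standardInvolution_add/sub/neg/smul/algebraMap/zero/one`,
  `standardInvolution_standardInvolution`;
* **anti-multiplicativity** `standardInvolution_mul_rev : (x y)‾ = ȳ x̄`;
* `trd(x̄) = trd x`, `nrd(x̄) = nrd x`, `x + x̄ = trd x`, `trd(x y) = trd(y x)`,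
  `nrd(c x) = c² nrd x`, `nrd(-x) = nrd x`, `nrd 0 = 0` (`reducedNorm_apply_zero`), `trd 1 = 2`
  (`trd c = 2c` is the tree's `reducedTrace_algebraMap`, `QuaternionGLTwoClassesEmbedding.lean`);
* **polarisation** `reducedNorm_add : nrd(x + y) = nrd x + nrd y + trd(x ȳ)` and the symmetry
  `trd(x ȳ) = trd(y x̄)`;
* Kaplansky's relation (Voight (4.2.16)) `mul_add_mul_comm_eq`:
  `x y + y x = trd(y) x + trd(x) y - trd(x ȳ)`, so that `x y ≡ -y x` modulo `K x + K y + K`.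

All statements are for `[CharZero K] [IsQuaternionAlgebra K D]`; the model computations are in
`ℍ[K,a,b]` where `x̄ = star x`, `trd = 2 re`, `nrd = re² - a imI² - b imJ² + a b imK²`
(`standardInvolution_quaternionAlgebra`, `reducedTrace_quaternionAlgebra`,
`reducedNorm_quaternionAlgebra` of the tree).

## References

* M.-F. Vignéras, *Arithmétique des algèbres de quaternions*, LNM 800 (1980), Ch. I §1
  [VignerasLNM800].
* J. Voight, *Quaternion Algebras*, GTM 288 (2021), §3.2–3.3, (4.2.16) [Voight2021].
-/

noncomputable section

open scoped Quaternion

namespace Literature.NumberTheory.Automorphic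

/-! ### Model computations in `ℍ[K,a,b]` -/

section Model

variable {K : Type*} [Field K] [NeZero (2 : K)] {a b : K}

/-- `trd(x star y) = 2 (x.re y.re - a x.imI y.imI - b x.imJ y.imJ + a b x.imK y.imK)` in
`ℍ[K,a,b]`: the polar form of the norm form. [folklore] -/
theorem QuaternionAlgebra.reducedTrace_mul_star (x y : ℍ[K,a,b]) :
    reducedTrace K ℍ[K,a,b] (x * star y) =
      2 * (x.re * y.re - a * x.imI * y.imI - b * x.imJ * y.imJ + a * b * x.imK * y.imK) := by
  rw [reducedTrace_quaternionAlgebra]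
  simp only [_root_.QuaternionAlgebra.re_mul, _root_.QuaternionAlgebra.re_star,
    _root_.QuaternionAlgebra.imI_star, _root_.QuaternionAlgebra.imJ_star,
    _root_.QuaternionAlgebra.imK_star]
  ring

/-- Polarisation in the model: `nrd(x + y) = nrd x + nrd y + trd(x ȳ)` in `ℍ[K,a,b]`. [folklore] -/
theorem QuaternionAlgebra.reducedNorm_add (x y : ℍ[K,a,b]) :
    reducedNorm K ℍ[K,a,b] (x + y) = reducedNorm K ℍ[K,a,b] x + reducedNorm K ℍ[K,a,b] y +
      reducedTrace K ℍ[K,a,b] (x * standardInvolution K ℍ[K,a,b] y) := by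
  rw [standardInvolution_quaternionAlgebra, QuaternionAlgebra.reducedTrace_mul_star]
  simp only [reducedNorm_quaternionAlgebra, _root_.QuaternionAlgebra.re_add,
    _root_.QuaternionAlgebra.imI_add, _root_.QuaternionAlgebra.imJ_add,
    _root_.QuaternionAlgebra.imK_add]
  ring

/-- Kaplansky's relation in the model: `x y + y x = trd(y) x + trd(x) y - trd(x ȳ)`. [folklore] -/
theorem QuaternionAlgebra.mul_add_mul_comm_eq (x y : ℍ[K,a,b]) :
    x * y + y * x = algebraMap K _ (reducedTrace K ℍ[K,a,b] y) * x +
      algebraMap K _ (reducedTrace K ℍ[K,a,b] x) * y -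
        algebraMap K _ (reducedTrace K ℍ[K,a,b] (x * standardInvolution K ℍ[K,a,b] y)) := by
  rw [standardInvolution_quaternionAlgebra, QuaternionAlgebra.reducedTrace_mul_star,
    reducedTrace_quaternionAlgebra, reducedTrace_quaternionAlgebra]
  simp only [_root_.QuaternionAlgebra.algebraMap_eq]
  ext <;> simp <;> ring

end Model

/-! ### The abstract quaternion algebra -/

section Abstract

variable (K : Type*) {D : Type*} [Field K] [CharZero K] [Ring D] [Algebra K D]
  [IsQuaternionAlgebra K D]

omit [CharZero K] [IsQuaternionAlgebra K D] in
/-- `x̄ = trd(x) · 1 - x` (definitional unfolding). [folklore] -/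
theorem standardInvolution_def (x : D) :
    standardInvolution K D x = algebraMap K D (reducedTrace K D x) - x := rfl

omit [CharZero K] [IsQuaternionAlgebra K D] in
/-- The standard involution is additive. [folklore] -/
theorem standardInvolution_add (x y : D) :
    standardInvolution K D (x + y) = standardInvolution K D x + standardInvolution K D y := by
  simp only [standardInvolution, map_add]
  abel

omit [CharZero K] [IsQuaternionAlgebra K D] in
/-- The standard involution is compatible with negation. [folklore] -/
theorem standardInvolution_neg (x : D) : standardInvolution K D (-x) = -standardInvolution K D x := by
  simp only [standardInvolution, map_neg]
  abel

omit [CharZero K] [IsQuaternionAlgebra K D] in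
/-- The standard involution is compatible with subtraction. [folklore] -/
theorem standardInvolution_sub (x y : D) :
    standardInvolution K D (x - y) = standardInvolution K D x - standardInvolution K D y := by
  simp only [standardInvolution, map_sub]
  abel

omit [CharZero K] [IsQuaternionAlgebra K D] in
/-- The standard involution is `K`-linear. [folklore] -/
theorem standardInvolution_smul (c : K) (x : D) :
    standardInvolution K D (c • x) = c • standardInvolution K D x := by
  rw [standardInvolution, standardInvolution, map_smul, smul_eq_mul, map_mul, Algebra.smul_def,
    Algebra.smul_def, mul_sub]

omit [CharZero K] [IsQuaternionAlgebra K D] in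
/-- `0̄ = 0`. [folklore] -/
theorem standardInvolution_zero : standardInvolution K D 0 = 0 := by
  simp [standardInvolution]

/-- `c̄ = c` for scalars. [folklore] -/
theorem standardInvolution_algebraMap (c : K) :
    standardInvolution K D (algebraMap K D c) = algebraMap K D c := by
  obtain ⟨a, b, -, -, ⟨e⟩⟩ := IsQuaternionAlgebra.exists_algEquiv_quaternionAlgebra K D
  apply e.injective
  rw [← standardInvolution_algEquiv e, AlgEquiv.commutes, standardInvolution_quaternionAlgebra,
    _root_.QuaternionAlgebra.algebraMap_eq]
  ext <;> simp

/-- `1̄ = 1`. [folklore] -/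
theorem standardInvolution_one : standardInvolution K D 1 = 1 := by
  simpa using standardInvolution_algebraMap K (D := D) 1

/-- **The standard involution is involutive**: `x̄‾ = x` (Vignéras I §1). [cite: VignerasLNM800, Ch. I §1 Lemme 1.1] -/
theorem standardInvolution_standardInvolution (x : D) :
    standardInvolution K D (standardInvolution K D x) = x := by
  obtain ⟨a, b, -, -, ⟨e⟩⟩ := IsQuaternionAlgebra.exists_algEquiv_quaternionAlgebra K D
  apply e.injective
  rw [← standardInvolution_algEquiv e, ← standardInvolution_algEquiv e,
    standardInvolution_quaternionAlgebra, standardInvolution_quaternionAlgebra, star_star]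

/-- **The standard involution is an anti-automorphism**: `(x y)‾ = ȳ x̄` (Vignéras I §1). [cite: VignerasLNM800, Ch. I §1 Lemme 1.1] -/
theorem standardInvolution_mul_rev (x y : D) :
    standardInvolution K D (x * y) = standardInvolution K D y * standardInvolution K D x := by
  obtain ⟨a, b, -, -, ⟨e⟩⟩ := IsQuaternionAlgebra.exists_algEquiv_quaternionAlgebra K D
  apply e.injective
  rw [← standardInvolution_algEquiv e, map_mul, map_mul, ← standardInvolution_algEquiv e,
    ← standardInvolution_algEquiv e, standardInvolution_quaternionAlgebra,
    standardInvolution_quaternionAlgebra, standardInvolution_quaternionAlgebra, star_mul]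

omit [CharZero K] [IsQuaternionAlgebra K D] in
/-- `x + x̄ = trd(x)` (Vignéras I §1: `t(h) = h + h̄`). [cite: VignerasLNM800, Ch. I §1 Lemme 1.1] -/
theorem self_add_standardInvolution (x : D) :
    x + standardInvolution K D x = algebraMap K D (reducedTrace K D x) := by
  rw [standardInvolution]
  abel

omit [CharZero K] [IsQuaternionAlgebra K D] in
/-- `trd(x y) = trd(y x)`: the reduced trace is the trace of left multiplication, up to `½`. [folklore] -/
theorem reducedTrace_mul_comm (x y : D) : reducedTrace K D (x * y) = reducedTrace K D (y * x) := by
  simp only [reducedTrace, LinearMap.smul_apply, leftMulTrace_apply, map_mul]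
  rw [LinearMap.trace_mul_comm]

/-- `trd(x̄) = trd(x)`. [folklore] -/
theorem reducedTrace_standardInvolution (x : D) :
    reducedTrace K D (standardInvolution K D x) = reducedTrace K D x := by
  obtain ⟨a, b, -, -, ⟨e⟩⟩ := IsQuaternionAlgebra.exists_algEquiv_quaternionAlgebra K D
  rw [← reducedTrace_algEquiv e, ← reducedTrace_algEquiv e x, ← standardInvolution_algEquiv e,
    standardInvolution_quaternionAlgebra, reducedTrace_quaternionAlgebra,
    reducedTrace_quaternionAlgebra, _root_.QuaternionAlgebra.re_star]
  ring

/-- `nrd(x̄) = nrd(x)`. [folklore] -/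
theorem reducedNorm_standardInvolution (x : D) :
    reducedNorm K D (standardInvolution K D x) = reducedNorm K D x := by
  obtain ⟨a, b, -, -, ⟨e⟩⟩ := IsQuaternionAlgebra.exists_algEquiv_quaternionAlgebra K D
  rw [← reducedNorm_algEquiv e, ← reducedNorm_algEquiv e x, ← standardInvolution_algEquiv e,
    standardInvolution_quaternionAlgebra, reducedNorm_quaternionAlgebra,
    reducedNorm_quaternionAlgebra]
  simp only [_root_.QuaternionAlgebra.re_star, _root_.QuaternionAlgebra.imI_star,
    _root_.QuaternionAlgebra.imJ_star, _root_.QuaternionAlgebra.imK_star]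
  ring

/-- `trd(1) = 2` (from the tree's `reducedTrace_algebraMap : trd(c) = 2c`). [folklore] -/
theorem reducedTrace_one : reducedTrace K D (1 : D) = 2 := by
  simpa using reducedTrace_algebraMap K D 1

omit [CharZero K] [IsQuaternionAlgebra K D] in
/-- `nrd(0) = 0` (any `K`-algebra `D`; the tree's `reducedNorm_zero` is the case `K = ℚ`). [folklore] -/
theorem reducedNorm_apply_zero : reducedNorm K D (0 : D) = 0 := by
  simp [reducedNorm]

/-- `nrd(c x) = c² nrd(x)`. [folklore] -/
theorem reducedNorm_smul (c : K) (x : D) : reducedNorm K D (c • x) = c ^ 2 * reducedNorm K D x := by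
  obtain ⟨a, b, -, -, ⟨e⟩⟩ := IsQuaternionAlgebra.exists_algEquiv_quaternionAlgebra K D
  rw [← reducedNorm_algEquiv e, ← reducedNorm_algEquiv e x, map_smul, reducedNorm_quaternionAlgebra,
    reducedNorm_quaternionAlgebra]
  simp only [_root_.QuaternionAlgebra.re_smul, _root_.QuaternionAlgebra.imI_smul,
    _root_.QuaternionAlgebra.imJ_smul, _root_.QuaternionAlgebra.imK_smul, smul_eq_mul]
  ring

/-- `nrd(-x) = nrd(x)`. [folklore] -/
theorem reducedNorm_neg (x : D) : reducedNorm K D (-x) = reducedNorm K D x := by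
  rw [← neg_one_smul K x, reducedNorm_smul]
  ring

/-- `nrd(c) = c²` for scalars. [folklore] -/
theorem reducedNorm_algebraMap (c : K) : reducedNorm K D (algebraMap K D c) = c ^ 2 := by
  rw [Algebra.algebraMap_eq_smul_one, reducedNorm_smul, reducedNorm_one K D, mul_one]

/-- **Polarisation**: `nrd(x + y) = nrd x + nrd y + trd(x ȳ)` (Vignéras I §1: the bilinear form
associated with the norm form is `trd(x ȳ)`). [cite: VignerasLNM800, Ch. I §1 Lemme 1.1] -/
theorem reducedNorm_add (x y : D) :
    reducedNorm K D (x + y) = reducedNorm K D x + reducedNorm K D y +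
      reducedTrace K D (x * standardInvolution K D y) := by
  obtain ⟨a, b, -, -, ⟨e⟩⟩ := IsQuaternionAlgebra.exists_algEquiv_quaternionAlgebra K D
  rw [← reducedNorm_algEquiv e, ← reducedNorm_algEquiv e x, ← reducedNorm_algEquiv e y,
    ← reducedTrace_algEquiv e, map_mul, ← standardInvolution_algEquiv e, map_add]
  exact QuaternionAlgebra.reducedNorm_add (e x) (e y)

/-- `nrd(x - y) = nrd x + nrd y - trd(x ȳ)`. [folklore] -/
theorem reducedNorm_sub (x y : D) :
    reducedNorm K D (x - y) = reducedNorm K D x + reducedNorm K D y -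
      reducedTrace K D (x * standardInvolution K D y) := by
  rw [sub_eq_add_neg, reducedNorm_add, reducedNorm_neg, standardInvolution_neg, mul_neg, map_neg]
  ring

/-- Symmetry of the polar form: `trd(x ȳ) = trd(y x̄)`. [folklore] -/
theorem reducedTrace_mul_standardInvolution_comm (x y : D) :
    reducedTrace K D (x * standardInvolution K D y) = reducedTrace K D (y * standardInvolution K D x) := by
  have h1 := reducedNorm_add K x y
  have h2 := reducedNorm_add K y x
  rw [add_comm y x] at h2
  linear_combination -h1 + h2

/-- `trd(x x̄) = 2 nrd(x)`. [folklore] -/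
theorem reducedTrace_mul_standardInvolution_self (x : D) :
    reducedTrace K D (x * standardInvolution K D x) = 2 * reducedNorm K D x := by
  rw [mul_standardInvolution_holds K D x, reducedTrace_algebraMap]

/-- **Kaplansky's relation** (Voight (4.2.16)): `x y + y x = trd(y) x + trd(x) y - trd(x ȳ)`;
in particular `x y ≡ -y x` modulo `K + K x + K y`. [cite: Voight2021, (4.2.16)] -/
theorem mul_add_mul_comm_eq (x y : D) :
    x * y + y * x = algebraMap K D (reducedTrace K D y) * x + algebraMap K D (reducedTrace K D x) * y -
      algebraMap K D (reducedTrace K D (x * standardInvolution K D y)) := by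
  obtain ⟨a, b, -, -, ⟨e⟩⟩ := IsQuaternionAlgebra.exists_algEquiv_quaternionAlgebra K D
  apply e.injective
  simp only [map_add, map_mul, map_sub, AlgEquiv.commutes]
  rw [← reducedTrace_algEquiv e y, ← reducedTrace_algEquiv e x,
    ← reducedTrace_algEquiv e (x * _), map_mul, ← standardInvolution_algEquiv e]
  exact QuaternionAlgebra.mul_add_mul_comm_eq (e x) (e y)

/-- `x² = trd(x) x - nrd(x)` with scalar multiplication (restating the tree's
`mul_self_eq_reducedTrace_mul_sub_reducedNorm`). [cite: VignerasLNM800, Ch. I §1 Lemme 1.1] -/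
theorem mul_self_eq_smul_sub (x : D) :
    x * x = reducedTrace K D x • x - algebraMap K D (reducedNorm K D x) := by
  rw [mul_self_eq_reducedTrace_mul_sub_reducedNorm K D x, Algebra.smul_def]

/-- The inverse of a non-zero-norm element: `x⁻¹ = nrd(x)⁻¹ x̄`, in the form
`x * (nrd(x)⁻¹ • x̄) = 1`. [folklore] -/
theorem mul_inv_smul_standardInvolution {x : D} (hx : reducedNorm K D x ≠ 0) :
    x * ((reducedNorm K D x)⁻¹ • standardInvolution K D x) = 1 := by
  rw [mul_smul_comm, mul_standardInvolution_holds K D x, Algebra.algebraMap_eq_smul_one, smul_smul,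
    inv_mul_cancel₀ hx, one_smul]

/-- `(nrd(x)⁻¹ • x̄) * x = 1` for `nrd x ≠ 0`. [folklore] -/
theorem inv_smul_standardInvolution_mul {x : D} (hx : reducedNorm K D x ≠ 0) :
    ((reducedNorm K D x)⁻¹ • standardInvolution K D x) * x = 1 := by
  rw [smul_mul_assoc, IsQuaternionAlgebra.standardInvolution_mul, Algebra.algebraMap_eq_smul_one,
    smul_smul, inv_mul_cancel₀ hx, one_smul]

end Abstract

end Literature.NumberTheory.Automorphic
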